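import Mathlib
import Literature.Analysis.FluidPDE.TypeIICoreWitness
import Literature.Analysis.FluidPDE.SuitableWeak
import Summits.NavierStokesRegularity.NavierStokesRegularity.Theorems.TypeIIInviscidRelaxationMonopoleCoreExclusionAnchorObstructionFamily
import Summits.NavierStokesRegularity.NavierStokesRegularity.Theorems.TypeIIInviscidRelaxationCoreExclusionAnchorObstructionLate
import HarnessLib

/-!
# Crux `MonopoleCoreExclusion` (stmt-1965): even LATE axisymmetric witnesses at every level give neither a
# core-radius floor nor anchoring — the floor hypothesis of the axisymmetric anchor reduction is independently necessary

`--supports stmt-NavierStokesRegularity-1965` (helper file, negative side; theorems only, no definitions, no `sorry`).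
Axisymmetric twin of `CoreExclusionAnchorObstruction.exists_lateColumnarWitnesses_unfloored_unanchored` (p832667), for
the axisymmetric reduction `CoreExclusionAnchor.anchoredLateAxisymWitness_of_lateWitnesses_radiusFloor` (p831180).
The family (`exists_lateAxisymWitnesses_unfloored_unanchored`): with `σ = (1-t)^{1/4}`, the core-plus-spoiler-shell
configuration of `mul_sub_one_lt_of_shellSpoiler` with core radius `a = σ²/8`, shell `2σ ≤ ‖x - c‖ ≤ 4σ` carrying
`(σ⁻³/3)e_x`, speed `σ⁻³` (intermediate rate `(1-t)^{-3/4}`), centred at `c(t) = 12σ·e_y → 0`.  It carries LATE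
axisymmetric witnesses at EVERY level frequently before `T = 1` (core length `σ/K`, lateness with equality), is not
Type I, has the origin as unique singular point — and every axisymmetric datum (`K ≥ 25`, `0 < t < 1`) satisfying the
speed-bound, near-maximum and closeness clauses has `K·L < 5σ → 0` (no floor) and `dist 0 x₀ > K·L/4` (unanchored).
Nothing about Navier–Stokes is claimed; `u` is not a solution; no stub or crux is proved or refuted here.
-/

noncomputable section

open Set Metric Filter Topology
open Literature.Analysis Literature.Analysis.FluidPDE

namespace Summit.NavierStokesRegularity.NavierStokesRegularity.Theorems

-- the problem directory repeats the summit name (`NavierStokesRegularity/NavierStokesRegularity`)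
set_option linter.dupNamespace false

namespace MonopoleAnchorObstruction

open CoreExclusionAnchorObstruction (sqrt_sqrt_pos_and_pow_four sqrt_sqrt_one_sub)

/-- `‖e_z‖ = 1` (file-local copy). [folklore] -/
private theorem norm_eZ_l : ‖(eZ : EuclideanSpace ℝ (Fin 3))‖ = 1 := by
  simp [eZ]

/-- Dilated radial cones `y ↦ max 0 (1 - ‖λ y‖) • e_z` are axisymmetric. [folklore] -/
theorem isAxisymmetric_radialCone_dilate (c : ℝ) :
    IsAxisymmetric (fun y : EuclideanSpace ℝ (Fin 3) => max 0 (1 - ‖c • y‖) • (eZ : EuclideanSpace ℝ (Fin 3))) := by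
  intro θ y
  simp only [norm_smul, norm_rotZ, rotZ_smul_eZ]

/-- **Late axisymmetric witnesses at every level, yet no floor and no anchoring** (kinematic; see the module
docstring). [folklore] -/
theorem exists_lateAxisymWitnesses_unfloored_unanchored :
    ∃ u : ℝ → EuclideanSpace ℝ (Fin 3) → EuclideanSpace ℝ (Fin 3),
      (∀ K : ℝ, 0 < K → ∀ t₀ < (1 : ℝ), ∃ t, t₀ < t ∧ t < 1 ∧
        ∃ (x₀ : EuclideanSpace ℝ (Fin 3)) (L V : ℝ)
          (Q : EuclideanSpace ℝ (Fin 3) ≃ₗᵢ[ℝ] EuclideanSpace ℝ (Fin 3))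
          (W : EuclideanSpace ℝ (Fin 3) → EuclideanSpace ℝ (Fin 3)),
          0 < L ∧ 0 < V ∧ IsAxisymmetric W ∧ (∀ x, ‖u t x‖ ≤ V) ∧
          (∃ x₁, dist x₁ x₀ ≤ L ∧ V ≤ 2 * ‖u t x₁‖) ∧
          (∃ y y' : EuclideanSpace ℝ (Fin 3), ‖y‖ ≤ 1 ∧ ‖y'‖ ≤ 1 ∧ (4 : ℝ)⁻¹ ≤ ‖W y - W y'‖) ∧
          K * 1 ≤ L * V ∧
          (∀ y : EuclideanSpace ℝ (Fin 3), ‖y‖ ≤ K →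
            ‖V⁻¹ • Q.symm (u t (x₀ + L • Q y)) - W y‖ ≤ K⁻¹) ∧
          (1 - t) * V ≤ K * L) ∧
      ¬ IsTypeIBlowup u 1 ∧
      (¬ ∃ ρ M : ℝ, 0 < ρ ∧ ∀ s ∈ Ioo (1 - ρ ^ 2) 1, ∀ x ∈ ball (0 : EuclideanSpace ℝ (Fin 3)) ρ,
        ‖u s x‖ ≤ M) ∧
      (∀ xr : EuclideanSpace ℝ (Fin 3), xr ≠ 0 → ∃ ρ M : ℝ, 0 < ρ ∧ ∀ s ∈ Ioo (1 - ρ ^ 2) 1,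
        ∀ x ∈ ball xr ρ, ‖u s x‖ ≤ M) ∧
      (∀ (K t : ℝ), 25 ≤ K → 0 < t → t < 1 →
        ∀ (x₀ : EuclideanSpace ℝ (Fin 3)) (L V : ℝ)
          (Q : EuclideanSpace ℝ (Fin 3) ≃ₗᵢ[ℝ] EuclideanSpace ℝ (Fin 3))
          (W : EuclideanSpace ℝ (Fin 3) → EuclideanSpace ℝ (Fin 3)),
          0 < L → 0 < V → IsAxisymmetric W → (∀ x, ‖u t x‖ ≤ V) →
          (∃ x₁, dist x₁ x₀ ≤ L ∧ V ≤ 2 * ‖u t x₁‖) →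
          (∀ y : EuclideanSpace ℝ (Fin 3), ‖y‖ ≤ K →
            ‖V⁻¹ • Q.symm (u t (x₀ + L • Q y)) - W y‖ ≤ K⁻¹) →
          K * L < 5 * Real.sqrt (Real.sqrt (1 - t)) ∧ K * L / 4 < dist 0 x₀) := by
  -- fourth root, centred slice (core radius `σ²/8`, shell `[2σ, 4σ]`, speed `σ⁻³`), centre `12σ e_y`
  set σ : ℝ → ℝ := fun t => Real.sqrt (Real.sqrt (1 - t)) with hσ
  set F : ℝ → EuclideanSpace ℝ (Fin 3) → EuclideanSpace ℝ (Fin 3) :=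
    fun t z => if ‖z‖ ≤ σ t ^ 2 / 8
      then ((σ t)⁻¹ ^ 3 * max 0 (1 - ‖z‖ / (σ t ^ 2 / 8))) • (eZ : EuclideanSpace ℝ (Fin 3))
      else if 2 * σ t ≤ ‖z‖ ∧ ‖z‖ ≤ 2 * (2 * σ t)
        then ((σ t)⁻¹ ^ 3 / 3) • EuclideanSpace.single 0 1 else 0 with hF
  set c : ℝ → EuclideanSpace ℝ (Fin 3) := fun t => (12 * σ t) • EuclideanSpace.single 1 1 with hc
  set u : ℝ → EuclideanSpace ℝ (Fin 3) → EuclideanSpace ℝ (Fin 3) := fun t x => F t (x - c t) with hu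
  have hσpos : ∀ t < (1 : ℝ), 0 < σ t := fun t ht => (sqrt_sqrt_pos_and_pow_four ht).1
  have hσ4 : ∀ t < (1 : ℝ), σ t ^ 4 = 1 - t := fun t ht => (sqrt_sqrt_pos_and_pow_four ht).2.2
  have hσle1 : ∀ t : ℝ, 0 < t → t < 1 → σ t ≤ 1 := by
    intro t ht0 ht1
    have h1 : σ t ^ 4 ≤ 1 ^ 4 := by rw [hσ4 t ht1, one_pow]; linarith
    exact (pow_le_pow_iff_left₀ (hσpos t ht1).le zero_le_one (by norm_num)).1 h1
  have hnc : ∀ t < (1 : ℝ), ‖c t‖ = 12 * σ t := by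
    intro t ht
    simp only [hc, norm_smul, Real.norm_of_nonneg (by linarith [hσpos t ht] : (0:ℝ) ≤ 12 * σ t)]
    simp
  -- region clauses of the centred slice, `0 < t < 1`
  have hcl : ∀ t : ℝ, 0 < t → t < 1 →
      (∀ z : EuclideanSpace ℝ (Fin 3), ‖z‖ ≤ σ t ^ 2 / 8 →
        F t z = ((σ t)⁻¹ ^ 3 * max 0 (1 - ‖z‖ / (σ t ^ 2 / 8))) • (eZ : EuclideanSpace ℝ (Fin 3))) ∧
      (∀ z : EuclideanSpace ℝ (Fin 3), σ t ^ 2 / 8 < ‖z‖ → ‖z‖ < 2 * σ t → F t z = 0) ∧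
      (∀ z : EuclideanSpace ℝ (Fin 3), 2 * σ t ≤ ‖z‖ → ‖z‖ ≤ 2 * (2 * σ t) →
        F t z = ((σ t)⁻¹ ^ 3 / 3) • EuclideanSpace.single 0 1) ∧
      (∀ z : EuclideanSpace ℝ (Fin 3), 2 * (2 * σ t) < ‖z‖ → F t z = 0) := by
    intro t ht0 ht1
    have hs0 := hσpos t ht1
    have hs1 := hσle1 t ht0 ht1
    have haD : σ t ^ 2 / 8 < 2 * σ t := by nlinarith
    refine ⟨fun z hz => by simp only [hF, if_pos hz], fun z hz1 hz2 => ?_, fun z hz1 hz2 => ?_, fun z hz => ?_⟩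
    · have h1 : ¬ ‖z‖ ≤ σ t ^ 2 / 8 := not_le.2 hz1
      have h2 : ¬ (2 * σ t ≤ ‖z‖ ∧ ‖z‖ ≤ 2 * (2 * σ t)) := fun h => absurd h.1 (not_le.2 hz2)
      simp only [hF, if_neg h1, if_neg h2]
    · have h1 : ¬ ‖z‖ ≤ σ t ^ 2 / 8 := not_le.2 (haD.trans_le hz1)
      have h2 : 2 * σ t ≤ ‖z‖ ∧ ‖z‖ ≤ 2 * (2 * σ t) := ⟨hz1, hz2⟩
      simp only [hF, if_neg h1, if_pos h2]
    · have h1 : ¬ ‖z‖ ≤ σ t ^ 2 / 8 := not_le.2 (by linarith)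
      have h2 : ¬ (2 * σ t ≤ ‖z‖ ∧ ‖z‖ ≤ 2 * (2 * σ t)) := fun h => absurd h.2 (not_le.2 hz)
      simp only [hF, if_neg h1, if_neg h2]
  have hsizes : ∀ t : ℝ, 0 < t → t < 1 →
      (∀ z, ‖F t z‖ ≤ (σ t)⁻¹ ^ 3) ∧ (∀ z, σ t ^ 2 / 8 < ‖z‖ → 3 * ‖F t z‖ ≤ (σ t)⁻¹ ^ 3) ∧
        F t 0 = ((σ t)⁻¹ ^ 3) • (eZ : EuclideanSpace ℝ (Fin 3)) := by
    intro t ht0 ht1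
    have hs0 := hσpos t ht1
    obtain ⟨f1, f2, f3, f4⟩ := hcl t ht0 ht1
    exact shellSpoiler_sizes (by positivity) (by positivity) f1 f2 f3 f4
  have huF : ∀ t x, u t x = F t (x - c t) := fun t x => rfl
  have huc : ∀ t, 0 < t → t < 1 → ‖u t (c t)‖ = (σ t)⁻¹ ^ 3 := by
    intro t ht0 ht1
    have hs0 := hσpos t ht1
    obtain ⟨-, -, h0⟩ := hsizes t ht0 ht1
    rw [huF, sub_self, h0, norm_smul, norm_eZ_l, mul_one, Real.norm_of_nonneg (by positivity)]
  have hbound : ∀ t, 0 < t → t < 1 → ∀ x, ‖u t x‖ ≤ (σ t)⁻¹ ^ 3 := by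
    intro t ht0 ht1 x
    obtain ⟨h, -, -⟩ := hsizes t ht0 ht1
    rw [huF]; exact h _
  have hsupp : ∀ t, 0 < t → t < 1 → ∀ x, u t x ≠ 0 → ‖x - c t‖ ≤ 4 * σ t := by
    intro t ht0 ht1 x hx
    obtain ⟨-, -, -, f4⟩ := hcl t ht0 ht1
    by_contra h
    exact hx (by rw [huF]; exact f4 _ (by linarith))
  -- the obstruction, recentred: `L (K-1) < 4σ` and `σ⁻³ ≤ V`
  have hobs : ∀ (K t : ℝ), 25 ≤ K → 0 < t → t < 1 →
      ∀ (x₀ : EuclideanSpace ℝ (Fin 3)) (L V : ℝ)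
        (Q : EuclideanSpace ℝ (Fin 3) ≃ₗᵢ[ℝ] EuclideanSpace ℝ (Fin 3))
        (W : EuclideanSpace ℝ (Fin 3) → EuclideanSpace ℝ (Fin 3)),
        0 < L → 0 < V → IsAxisymmetric W → (∀ x, ‖u t x‖ ≤ V) →
        (∃ x₁, dist x₁ x₀ ≤ L ∧ V ≤ 2 * ‖u t x₁‖) →
        (∀ y : EuclideanSpace ℝ (Fin 3), ‖y‖ ≤ K →
          ‖V⁻¹ • Q.symm (u t (x₀ + L • Q y)) - W y‖ ≤ K⁻¹) →
        L * (K - 1) < 4 * σ t ∧ (σ t)⁻¹ ^ 3 ≤ V := by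
    intro K t hK ht0 ht1 x₀ L V Q W hL hV hW hbd hnear hclose
    have hs0 := hσpos t ht1
    have hs1 := hσle1 t ht0 ht1
    obtain ⟨f1, f2, f3, f4⟩ := hcl t ht0 ht1
    have hDa : 4 * (σ t ^ 2 / 8) ≤ 2 * σ t := by nlinarith
    have hbd' : ∀ z, ‖F t z‖ ≤ V := fun z => by
      have h := hbd (z + c t); rwa [huF, add_sub_cancel_right] at h
    have hnear' : ∃ x₁, dist x₁ (x₀ - c t) ≤ L ∧ V ≤ 2 * ‖F t x₁‖ := by
      obtain ⟨x₁, hx₁, hVx₁⟩ := hnear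
      refine ⟨x₁ - c t, by rwa [dist_sub_right], by rwa [huF] at hVx₁⟩
    have hclose' : ∀ y : EuclideanSpace ℝ (Fin 3), ‖y‖ ≤ K →
        ‖V⁻¹ • Q.symm (F t ((x₀ - c t) + L • Q y)) - W y‖ ≤ K⁻¹ := by
      intro y hy
      have h := hclose y hy
      rwa [huF, add_sub_right_comm] at h
    have h := mul_sub_one_lt_of_shellSpoiler (by positivity) (by positivity) hDa f1 f2 f3 f4 hK hL hV hW hbd'
      hnear' hclose'
    refine ⟨by linarith, ?_⟩
    rw [← huc t ht0 ht1]
    exact hbd (c t)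
  refine ⟨u, ?_, ?_, ?_, ?_, ?_⟩
  · -- (i) LATE axisymmetric witnesses at every level frequently before `1`
    intro K hK t₀ ht₀
    set κ : ℝ := max K 1 with hκ
    have hκ1 : 1 ≤ κ := le_max_right _ _
    have hκK : K ≤ κ := le_max_left _ _
    have hκ0 : 0 < κ := one_pos.trans_le hκ1
    set t : ℝ := (max (max t₀ 0) (1 - (κ ^ 4)⁻¹) + 1) / 2 with ht
    have hκ4 : 0 < (κ ^ 4)⁻¹ := by positivity
    have hmax_lt : max (max t₀ 0) (1 - (κ ^ 4)⁻¹) < 1 := max_lt (max_lt ht₀ one_pos) (by linarith)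
    have ht₀t : t₀ < t := by
      have := (le_max_left t₀ 0).trans (le_max_left (max t₀ 0) (1 - (κ ^ 4)⁻¹)); rw [ht]; linarith
    have ht0 : 0 < t := by
      have := (le_max_right t₀ 0).trans (le_max_left (max t₀ 0) (1 - (κ ^ 4)⁻¹)); rw [ht]; linarith
    have ht1 : t < 1 := by rw [ht]; linarith
    have hsκ : 1 - t ≤ (κ ^ 4)⁻¹ := by
      have := le_max_right (max t₀ 0) (1 - (κ ^ 4)⁻¹); rw [ht]; linarith
    have hσ0 := hσpos t ht1
    have hσκ : σ t ≤ κ⁻¹ := by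
      have h1 : σ t ^ 4 ≤ (κ⁻¹) ^ 4 := by rw [hσ4 t ht1, inv_pow]; exact hsκ
      exact (pow_le_pow_iff_left₀ hσ0.le (by positivity) (by norm_num)).1 h1
    have hσK : σ t * K ≤ 1 := by
      calc σ t * K ≤ κ⁻¹ * κ := mul_le_mul hσκ hκK hK.le (by positivity)
        _ = 1 := inv_mul_cancel₀ hκ0.ne'
    obtain ⟨f1, f2, -, -⟩ := hcl t ht0 ht1
    -- the witness: centre `c t`, core length `σ/K`, speed `σ⁻³`, profile the dilated radial cone
    set L : ℝ := σ t / K with hL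
    have hL0 : 0 < L := by positivity
    have hKL : K * L = σ t := by rw [hL]; field_simp
    set lam : ℝ := 8 * (σ t * K)⁻¹ with hlam
    have hlam0 : 0 < lam := by positivity
    have hlam8 : 8 ≤ lam := by
      rw [hlam]
      have : 1 ≤ (σ t * K)⁻¹ := one_le_inv_iff₀.2 ⟨by positivity, hσK⟩
      linarith
    set W : EuclideanSpace ℝ (Fin 3) → EuclideanSpace ℝ (Fin 3) :=
      fun y => max 0 (1 - ‖lam • y‖) • (eZ : EuclideanSpace ℝ (Fin 3)) with hW
    have hW0 : W 0 = eZ := by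
      simp only [hW, smul_zero, norm_zero, sub_zero, max_eq_right zero_le_one, one_smul]
    have hW1 : W (EuclideanSpace.single 0 1) = 0 := by
      have hn : ‖lam • EuclideanSpace.single (0 : Fin 3) (1 : ℝ)‖ = lam := by
        rw [norm_smul, Real.norm_of_nonneg hlam0.le]; simp
      simp only [hW]
      rw [hn, max_eq_left (by linarith), zero_smul]
    refine ⟨t, ht₀t, ht1, c t, L, (σ t)⁻¹ ^ 3, LinearIsometryEquiv.refl ℝ _, W, hL0, by positivity,
      isAxisymmetric_radialCone_dilate lam, hbound t ht0 ht1, ?_, ?_, ?_, ?_, ?_⟩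
    · refine ⟨c t, by rw [dist_self]; exact hL0.le, ?_⟩
      rw [huc t ht0 ht1]; linarith [pow_pos (inv_pos.2 hσ0) 3]
    · refine ⟨0, EuclideanSpace.single 0 1, by simp, by simp, ?_⟩
      rw [hW0, hW1, sub_zero, norm_eZ_l]
      norm_num
    · -- Reynolds: `K ≤ (σ/K) σ⁻³`
      rw [mul_one, hL]
      have h1 : σ t / K * (σ t)⁻¹ ^ 3 = 1 / (K * σ t ^ 2) := by field_simp
      rw [h1, le_div_iff₀ (by positivity)]
      calc K * (K * σ t ^ 2) = (σ t * K) ^ 2 := by ring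
        _ ≤ 1 := pow_le_one₀ (by positivity) hσK
    · -- closeness: exact (core formula inside `‖z‖ ≤ σ²/8`, zero in the gap `σ²/8 < ‖z‖ < 2σ`)
      intro y hy
      have hrefl : ∀ z : EuclideanSpace ℝ (Fin 3),
          (LinearIsometryEquiv.refl ℝ (EuclideanSpace ℝ (Fin 3))).symm z = z := fun z => rfl
      have hphys : u t (c t + L • (LinearIsometryEquiv.refl ℝ _ y)) = F t (L • y) := by
        rw [huF]
        simp only [LinearIsometryEquiv.coe_refl, id_eq, add_sub_cancel_left]
      have hnz : ‖L • y‖ = L * ‖y‖ := by rw [norm_smul, Real.norm_of_nonneg hL0.le]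
      have hzσ : ‖L • y‖ ≤ σ t := by
        rw [hnz]
        calc L * ‖y‖ ≤ L * K := mul_le_mul_of_nonneg_left hy hL0.le
          _ = σ t := by rw [mul_comm, hKL]
      have hlamL : lam * ‖y‖ = L * ‖y‖ / (σ t ^ 2 / 8) := by
        rw [hlam, hL]; field_simp
      have hnlam : ‖lam • y‖ = lam * ‖y‖ := by rw [norm_smul, Real.norm_of_nonneg hlam0.le]
      rw [hphys, hrefl]
      by_cases hin : ‖L • y‖ ≤ σ t ^ 2 / 8
      · rw [f1 _ hin, smul_smul, ← mul_assoc, inv_mul_cancel₀ (by positivity : (σ t)⁻¹ ^ 3 ≠ 0), one_mul,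
          hnz, ← hlamL, ← hnlam]
        change ‖W y - W y‖ ≤ K⁻¹
        rw [sub_self, norm_zero]; positivity
      · push Not at hin
        rw [f2 _ hin (by linarith [hσ0]), smul_zero, zero_sub, norm_neg]
        have hbig : 1 ≤ ‖lam • y‖ := by
          rw [hnlam, hlamL, le_div_iff₀ (by positivity), one_mul, ← hnz]; exact hin.le
        change ‖max 0 (1 - ‖lam • y‖) • (eZ : EuclideanSpace ℝ (Fin 3))‖ ≤ K⁻¹
        rw [max_eq_left (by linarith), zero_smul, norm_zero]; positivity
    · -- late, with equality: `(1-t) σ⁻³ = σ = K L`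
      rw [hKL, ← hσ4 t ht1]
      have : σ t ^ 4 * (σ t)⁻¹ ^ 3 = σ t := by field_simp
      rw [this]
  · -- (ii) faster than the Type-I rate at the centres
    rintro ⟨C, hC⟩
    obtain ⟨l, hl1, hsub⟩ := mem_nhdsLT_iff_exists_Ioo_subset.1 hC
    rw [mem_Iio] at hl1
    set a : ℝ := min (min 2⁻¹ ((1 - l) / 2)) (|C| + 2)⁻¹ with ha_def
    have hC2 : 0 < |C| + 2 := by positivity
    have ha0 : 0 < a := lt_min (lt_min (by norm_num) (by linarith)) (inv_pos.2 hC2)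
    have ha1 : a ≤ 2⁻¹ := (min_le_left _ _).trans (min_le_left _ _)
    have ha2 : a ≤ (1 - l) / 2 := (min_le_left _ _).trans (min_le_right _ _)
    have ha3 : a ≤ (|C| + 2)⁻¹ := min_le_right _ _
    have ha4 : a ^ 4 ≤ a := by
      have : a ^ 4 ≤ a ^ 1 := pow_le_pow_of_le_one ha0.le (by linarith) (by norm_num)
      rwa [pow_one] at this
    have hmem : 1 - a ^ 4 ∈ Ioo l 1 := ⟨by linarith, by linarith [pow_pos ha0 4]⟩
    have hlt1 : 1 - a ^ 4 < 1 := by linarith [pow_pos ha0 4]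
    have hgt0 : 0 < 1 - a ^ 4 := by nlinarith
    have hσa : σ (1 - a ^ 4) = a := sqrt_sqrt_one_sub a ha0.le
    have h : ‖u (1 - a ^ 4) (c (1 - a ^ 4))‖ ≤ C / Real.sqrt (1 - (1 - a ^ 4)) := hsub hmem (c (1 - a ^ 4))
    rw [huc (1 - a ^ 4) hgt0 hlt1, hσa, sub_sub_cancel, show a ^ 4 = (a ^ 2) ^ 2 by ring,
      Real.sqrt_sq (sq_nonneg a)] at h
    have h2 : a⁻¹ ≤ C := by
      have h3 : a⁻¹ ^ 3 * a ^ 2 ≤ C := by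
        have := mul_le_mul_of_nonneg_right h (sq_nonneg a)
        rwa [div_mul_cancel₀ _ (by positivity : a ^ 2 ≠ 0)] at this
      have h4 : a⁻¹ ^ 3 * a ^ 2 = a⁻¹ := by field_simp
      rwa [h4] at h3
    have h5 : |C| + 2 ≤ a⁻¹ := by rw [le_inv_comm₀ hC2 ha0]; exact ha3
    linarith [le_abs_self C]
  · -- (iii) the origin is singular
    rintro ⟨ρ, M, hρ, hbd⟩
    set a : ℝ := min (min (ρ / 13) 2⁻¹) (|M| + 2)⁻¹ with ha_def
    have hM2 : 0 < |M| + 2 := by positivity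
    have ha0 : 0 < a := lt_min (lt_min (by positivity) (by norm_num)) (inv_pos.2 hM2)
    have ha1 : a ≤ ρ / 13 := (min_le_left _ _).trans (min_le_left _ _)
    have ha2 : a ≤ 2⁻¹ := (min_le_left _ _).trans (min_le_right _ _)
    have ha3 : a ≤ (|M| + 2)⁻¹ := min_le_right _ _
    have ha4 : a ^ 4 < ρ ^ 2 := by
      have h1 : a ^ 2 ≤ (ρ / 13) ^ 2 := pow_le_pow_left₀ ha0.le ha1 2
      have h2 : a ^ 2 ≤ 4⁻¹ := by nlinarith
      nlinarith [pow_pos hρ 2]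
    have hmem : 1 - a ^ 4 ∈ Ioo (1 - ρ ^ 2) 1 := ⟨by linarith, by linarith [pow_pos ha0 4]⟩
    have hlt1 : 1 - a ^ 4 < 1 := by linarith [pow_pos ha0 4]
    have hgt0 : 0 < 1 - a ^ 4 := by
      have h1 : a ^ 4 ≤ (2⁻¹ : ℝ) ^ 4 := pow_le_pow_left₀ ha0.le ha2 4
      norm_num at h1
      linarith
    have hσa : σ (1 - a ^ 4) = a := sqrt_sqrt_one_sub a ha0.le
    have hcmem : c (1 - a ^ 4) ∈ ball (0 : EuclideanSpace ℝ (Fin 3)) ρ := by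
      rw [mem_ball, dist_zero_right, hnc _ hlt1, hσa]
      linarith
    have h := hbd (1 - a ^ 4) hmem (c (1 - a ^ 4)) hcmem
    rw [huc _ hgt0 hlt1, hσa] at h
    have h4 : |M| + 2 ≤ a⁻¹ := by rw [le_inv_comm₀ hM2 ha0]; exact ha3
    have h5 : a⁻¹ ≤ a⁻¹ ^ 3 := by
      have h6 : (1 : ℝ) ≤ a⁻¹ := one_le_inv_iff₀.2 ⟨ha0, by linarith⟩
      calc a⁻¹ = a⁻¹ ^ 1 := (pow_one _).symm
        _ ≤ a⁻¹ ^ 3 := pow_le_pow_right₀ h6 (by norm_num)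
    linarith [le_abs_self M]
  · -- (iii') every other point is regular
    intro xr hxr
    have hxr0 : 0 < ‖xr‖ := norm_pos_iff.2 hxr
    refine ⟨min (‖xr‖ / 4) 1, (3 * ‖xr‖ / 64)⁻¹ ^ 3, lt_min (by positivity) one_pos, fun s' hs' x hx => ?_⟩
    have hs'1 : s' < 1 := hs'.2
    have hmin1 : min (‖xr‖ / 4) 1 ≤ 1 := min_le_right _ _
    have hmin2 : min (‖xr‖ / 4) 1 ≤ ‖xr‖ / 4 := min_le_left _ _
    have hs'0 : 0 < s' := by
      have h1 : (min (‖xr‖ / 4) 1) ^ 2 ≤ 1 := by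
        have := pow_le_pow_left₀ (lt_min (by positivity) one_pos).le hmin1 2
        rwa [one_pow] at this
      linarith [hs'.1]
    have hσ0 := hσpos s' hs'1
    by_cases hσx : σ s' < 3 * ‖xr‖ / 64
    · have hfar : 4 * σ s' < ‖x - c s'‖ := by
        rw [mem_ball] at hx
        have h3 : ‖xr‖ ≤ dist xr (c s') + ‖c s'‖ := by
          rw [dist_eq_norm]
          calc ‖xr‖ = ‖(xr - c s') + c s'‖ := by rw [sub_add_cancel]
            _ ≤ ‖xr - c s'‖ + ‖c s'‖ := norm_add_le _ _
        have h2 : dist xr (c s') ≤ dist xr x + dist x (c s') := dist_triangle _ _ _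
        rw [dist_comm xr x] at h2
        rw [hnc s' hs'1] at h3
        rw [← dist_eq_norm]
        linarith
      have h0 : u s' x = 0 := by
        by_contra h
        exact absurd (hsupp s' hs'0 hs'1 x h) (not_le.2 hfar)
      rw [h0, norm_zero]
      positivity
    · push Not at hσx
      refine (hbound s' hs'0 hs'1 x).trans ?_
      exact pow_le_pow_left₀ (by positivity) (inv_anti₀ (by positivity) hσx) 3
  · -- (iv) no floor, never anchored at the singular point
    intro K t hK ht0 ht1 x₀ L V Q W hL hV hW hbd hnear hclose
    have hσ0 := hσpos t ht1
    obtain ⟨hLK, -⟩ := hobs K t hK ht0 ht1 x₀ L V Q W hL hV hW hbd hnear hclose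
    have hL72 : L * 24 ≤ L * (K - 1) := mul_le_mul_of_nonneg_left (by linarith) hL.le
    have hL6 : L < σ t / 6 := by linarith
    have hKL : K * L < 5 * σ t := by nlinarith
    refine ⟨hKL, ?_⟩
    obtain ⟨x₁, hx₁, hVx₁⟩ := hnear
    have hfx₁ : u t x₁ ≠ 0 := by
      intro h
      rw [h, norm_zero, mul_zero] at hVx₁
      exact absurd hVx₁ (not_le.2 hV)
    have hx₁c : dist x₁ (c t) ≤ 4 * σ t := by rw [dist_eq_norm]; exact hsupp t ht0 ht1 x₁ hfx₁
    have htri : 12 * σ t ≤ dist 0 x₀ + L + 4 * σ t := by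
      have h3 : dist (0 : EuclideanSpace ℝ (Fin 3)) (c t) = 12 * σ t := by
        rw [dist_comm, dist_zero_right, hnc t ht1]
      have h4 := dist_triangle (0 : EuclideanSpace ℝ (Fin 3)) x₀ (c t)
      have h5 := dist_triangle x₀ x₁ (c t)
      rw [dist_comm x₀ x₁] at h5
      linarith
    linarith

end MonopoleAnchorObstruction

end Summit.NavierStokesRegularity.NavierStokesRegularity.Theorems

end
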